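import Summits.KontsevichZagierPeriods.KontsevichZagierPeriods.Theorems.LinRedNormalFormArrangementNormalFormStubRebaseSimpleZeroNestedDiffE1Tools

/-!
# Stub `stub_rebaseSimpleZeroTwo`, part `rebaseSimpleZero_HDiff1_of_HPar1` (crux
`ArrangementNormalForm`, line `janus-bands`) — brick `NestedDiffE1Janus`

The three uses of the three-piece dissection (`RebaseE1.three_piece`) on a datum of `HDiff₁`
(`RebaseE1.IsDN`): the interior cut `IsDN.good_cut` (pieces are restrictions, rule 1a), the
SUB-SECTION Janus `IsDN.good_sub` (`[A<tᵢ<tⱼ<B] = [X<tᵢ<tⱼ<B] − [X<tᵢ<tⱼ<A] − [X<tᵢ<A]×[A<tⱼ<B]`)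
and the SUPER-SECTION Janus `IsDN.good_sup` (`[A<tᵢ<tⱼ<B] = [A<tᵢ<tⱼ<Z] − [A<tᵢ<B]×[B<tⱼ<Z] −
[B<tᵢ<tⱼ<Z]`), both signed, their analytic input being the absolute convergence of the literal
integrand on the larger nest; product pieces are good by the product case (`RebaseZero.good_literal`).
Then the position of the two letters of a datum with non-zero base constant: by absolute
convergence neither letter plane meets the domain (`RebaseDiff.letter_ne_of_integrableOn`) and the
letter forms have constant signs (`RebaseDiff.exists_letter_sign`); reading the sign near the
bounds, the constant inner letter `cᵢ` lies weakly BELOW `A` or weakly ABOVE `B` on the whole open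
interval (`IsDN.inner_side`), and so does the outer letter line `cⱼ` (`IsDN.outer_side`). Also: the
ends of an affine function non-negative on an open interval, the vanishing base constant
(`IsDN.good_zero`) and the margin bound of the literal integrand (`abs_glitB_le`).
Registered: `rebaseSimpleZero_E1letterSides`.

References: M. Kontsevich, D. Zagier, *Periods* (2001), §1.2; D. Zagier, *Values of zeta functions
and their applications* (1994), §9.
-/

noncomputable section

open Set MeasureTheory MvPolynomial
open Literature.NumberTheory.Transcendental Literature.ModelTheory.ExponentialFields

namespace Summit.KontsevichZagierPeriods.ArrangementNormalForm.JanusBands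

namespace RebaseE1

open SeparatePos RebasePos RebaseZero RebaseNest RebaseDiff

variable {i j : Fin 2} {s : KZ.IntegralRep (0 + 1 + 2)} {l u : ℚ} {A B : Cf} {T : BData}
  {p : MvPolynomial (Fin 0) ℚ} {a : Fin 2 → Option Cf} {ci cj : Cf}

/-! ### The three uses of the three-piece dissection -/

/-- The product piece is good (product case, worker W2). -/
theorem good_prod_piece {r₂ : KZ.IntegralRep (0 + 1 + 2)} (l u : ℚ) (U V : Fin 2 → Cf) (hadm : T.n₁ = 0 ∨ T.n₂ = 0)
    (hd : r₂.domain = pDom ![RebaseZero.mk 1 (-l), RebaseZero.mk (-1) u] U V)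
    (hi : EqOn r₂.integrand (glitB T p a) r₂.domain) : Good 2 (KZ.of r₂) :=
  good_literal r₂ _ T.L T.e p T.ℓ₁ T.ℓ₂ a (fun l => Sum.inr (U l)) (fun l => Sum.inr (V l)) hadm
    (fun l => ⟨⟨U l, rfl⟩, ⟨V l, rfl⟩⟩) (by rw [hd]; exact isBounded_pDom _ U V (cell_Ioo_bound l u)) hd hi

/-- **Interior cut** (rule 1a): for a section `Y` with `A < Y < B` on the open interval, the datum
is good as soon as the two nests `A < tᵢ < tⱼ < Y` and `Y < tᵢ < tⱼ < B` are (the product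
`{A < tᵢ < Y} × {Y < tⱼ < B}` is good by the product case). [Kontsevich–Zagier 2001, §1.2] -/
theorem IsDN.good_cut (h : IsDN s l u A B T p a i j) (hadm : T.n₁ = 0 ∨ T.n₂ = 0) (Y : Cf)
    (hAY : ∀ y : ℝ, (l : ℝ) < y → y < u → ev A y < ev Y y) (hYB : ∀ y : ℝ, (l : ℝ) < y → y < u → ev Y y < ev B y)
    (h₁ : ∀ s₁ : KZ.IntegralRep (0 + 1 + 2), IsDN s₁ l u A Y T p a i j → Good 2 (KZ.of s₁))
    (h₃ : ∀ s₃ : KZ.IntegralRep (0 + 1 + 2), IsDN s₃ l u Y B T p a i j → Good 2 (KZ.of s₃)) :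
    Good 2 (KZ.of s) := by
  obtain ⟨r₁, r₂, r₃, ⟨hd₁, hi₁⟩, ⟨hd₂, hi₂⟩, ⟨hd₃, hi₃⟩, hrel⟩ := three_piece s _ h.ne A Y B h.dom
    (fun y hy => (hAY y ((mem_cell_Ioo l u y).1 hy).1 ((mem_cell_Ioo l u y).1 hy).2).le)
    (fun y hy => (hYB y ((mem_cell_Ioo l u y).1 hy).1 ((mem_cell_Ioo l u y).1 hy).2).le)
  have hs₁ : r₁.domain ⊆ s.domain := fun z hz => by
    rw [hd₁, mem_nDom_Ioo h.ne] at hz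
    obtain ⟨hy, h1, h2, h3⟩ := hz
    exact (h.mem z).2 ⟨hy, h1, h2, h3.trans (hYB _ hy.1 hy.2)⟩
  have hs₂ : r₂.domain ⊆ s.domain := fun z hz => by
    rw [hd₂, mem_pDom, forall_fin_two_iff h.ne] at hz
    simp only [if_neg h.ne.symm] at hz
    obtain ⟨hy, ⟨h1, h2⟩, h3, h4⟩ := hz
    rw [mem_cell_Ioo] at hy
    exact (h.mem z).2 ⟨hy, h1, h2.trans h3, h4⟩
  have hs₃ : r₃.domain ⊆ s.domain := fun z hz => by
    rw [hd₃, mem_nDom_Ioo h.ne] at hz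
    obtain ⟨hy, h1, h2, h3⟩ := hz
    exact (h.mem z).2 ⟨hy, (hAY _ hy.1 hy.2).trans h1, h2, h3⟩
  have g₁ : Good 2 (KZ.of r₁) := h₁ r₁ ⟨h.ne, hd₁, fun z hz => by rw [hi₁]; exact h.int (hs₁ hz),
    h.bdd.subset hs₁, h.lu, hAY, h.pole⟩
  have g₂ : Good 2 (KZ.of r₂) := good_prod_piece l u _ _ hadm hd₂ fun z hz => by rw [hi₂]; exact h.int (hs₂ hz)
  have g₃ : Good 2 (KZ.of r₃) := h₃ r₃ ⟨h.ne, hd₃, fun z hz => by rw [hi₃]; exact h.int (hs₃ hz),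
    h.bdd.subset hs₃, h.lu, hYB, h.pole⟩
  have key : KZ.of s - (KZ.of r₁ + KZ.of r₂ + KZ.of r₃) ∈ KZ.relations := by
    convert hrel using 1; abel
  exact RebaseZero.good_of_sub_mem key ((g₁.add g₂).add g₃)

/-- **Sub-section Janus** (rules 1a + 2, signed). For a section `X < A` on the open interval such
that the literal integrand converges absolutely on the larger nest `X < tᵢ < tⱼ < B`,
`[A<tᵢ<tⱼ<B] = [X<tᵢ<tⱼ<B] − [X<tᵢ<tⱼ<A] − [X<tᵢ<A]×[A<tⱼ<B]` modulo `KZ.relations`; so the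
datum is good as soon as the two nests on the right are. [Kontsevich–Zagier 2001, §1.2] -/
theorem IsDN.good_sub (h : IsDN s l u A B T p a i j) (hadm : T.n₁ = 0 ∨ T.n₂ = 0) (X : Cf)
    (hXA : ∀ y : ℝ, (l : ℝ) < y → y < u → ev X y < ev A y)
    (hW : IntegrableOn (glitB T p a) (gDom 0 2 2 ![RebaseZero.mk 1 (-l), RebaseZero.mk (-1) u] (nlo i X) (nhi j B)))
    (hbig : ∀ W : KZ.IntegralRep (0 + 1 + 2), IsDN W l u X B T p a i j → Good 2 (KZ.of W))
    (hlow : ∀ r₁ : KZ.IntegralRep (0 + 1 + 2), IsDN r₁ l u X A T p a i j → Good 2 (KZ.of r₁)) :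
    Good 2 (KZ.of s) := by
  have hij := h.ne
  set DW := gDom 0 2 2 ![RebaseZero.mk 1 (-l), RebaseZero.mk (-1) u] (nlo i X) (nhi j B) with hDW
  set W : KZ.IntegralRep (0 + 1 + 2) := ⟨DW, glitB T p a, isSemialgebraic_gDom _ _ _ _,
    isSemialgebraicFunOn_glit (isSemialgebraic_gDom _ _ _ _) _ _ _ _ _ _ _ _, hW⟩ with hWdef
  have hWN : IsDN W l u X B T p a i j := ⟨hij, rfl, fun _ _ => rfl, isBounded_nDom_Ioo hij l u X B, h.lu,
    fun y h1 h2 => (hXA y h1 h2).trans (h.AB y h1 h2), h.pole⟩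
  obtain ⟨r₁, r₂, r₃, ⟨hd₁, hi₁⟩, ⟨hd₂, hi₂⟩, ⟨hd₃, hi₃⟩, hrel⟩ := three_piece W _ hij X A B rfl
    (fun y hy => (hXA y ((mem_cell_Ioo l u y).1 hy).1 ((mem_cell_Ioo l u y).1 hy).2).le)
    (fun y hy => (h.AB y ((mem_cell_Ioo l u y).1 hy).1 ((mem_cell_Ioo l u y).1 hy).2).le)
  have hb₁ : Bornology.IsBounded r₁.domain := by rw [hd₁]; exact isBounded_nDom_Ioo hij l u X A
  have g₁ : Good 2 (KZ.of r₁) := hlow r₁ ⟨hij, hd₁, fun z _ => by rw [hi₁], hb₁, h.lu, hXA, h.pole⟩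
  have g₂ : Good 2 (KZ.of r₂) := good_prod_piece l u _ _ hadm hd₂ fun z _ => by rw [hi₂]
  have e₃ : KZ.of s - KZ.of r₃ ∈ KZ.relations :=
    KZ.of_sub_of_mem_relations_of_eqOn (by rw [hd₃, h.dom]) fun z hz => by rw [hi₃]; exact h.int hz
  have key : KZ.of s - (KZ.of W - KZ.of r₁ - KZ.of r₂) ∈ KZ.relations := by
    have := sub_mem e₃ hrel
    convert this using 1; abel
  exact RebaseZero.good_of_sub_mem key (((hbig W hWN).sub g₁).sub g₂)

/-- **Super-section Janus** (rules 1a + 2, signed). For a section `Z > B` on the open interval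
such that the literal integrand converges absolutely on the larger nest `A < tᵢ < tⱼ < Z`,
`[A<tᵢ<tⱼ<B] = [A<tᵢ<tⱼ<Z] − [A<tᵢ<B]×[B<tⱼ<Z] − [B<tᵢ<tⱼ<Z]` modulo `KZ.relations`; so the
datum is good as soon as the two nests on the right are. [Kontsevich–Zagier 2001, §1.2] -/
theorem IsDN.good_sup (h : IsDN s l u A B T p a i j) (hadm : T.n₁ = 0 ∨ T.n₂ = 0) (Z : Cf)
    (hBZ : ∀ y : ℝ, (l : ℝ) < y → y < u → ev B y < ev Z y)
    (hW : IntegrableOn (glitB T p a) (gDom 0 2 2 ![RebaseZero.mk 1 (-l), RebaseZero.mk (-1) u] (nlo i A) (nhi j Z)))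
    (hbig : ∀ W : KZ.IntegralRep (0 + 1 + 2), IsDN W l u A Z T p a i j → Good 2 (KZ.of W))
    (hup : ∀ r₃ : KZ.IntegralRep (0 + 1 + 2), IsDN r₃ l u B Z T p a i j → Good 2 (KZ.of r₃)) :
    Good 2 (KZ.of s) := by
  have hij := h.ne
  set DW := gDom 0 2 2 ![RebaseZero.mk 1 (-l), RebaseZero.mk (-1) u] (nlo i A) (nhi j Z) with hDW
  set W : KZ.IntegralRep (0 + 1 + 2) := ⟨DW, glitB T p a, isSemialgebraic_gDom _ _ _ _,
    isSemialgebraicFunOn_glit (isSemialgebraic_gDom _ _ _ _) _ _ _ _ _ _ _ _, hW⟩ with hWdef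
  have hWN : IsDN W l u A Z T p a i j := ⟨hij, rfl, fun _ _ => rfl, isBounded_nDom_Ioo hij l u A Z, h.lu,
    fun y h1 h2 => (h.AB y h1 h2).trans (hBZ y h1 h2), h.pole⟩
  obtain ⟨r₁, r₂, r₃, ⟨hd₁, hi₁⟩, ⟨hd₂, hi₂⟩, ⟨hd₃, hi₃⟩, hrel⟩ := three_piece W _ hij A B Z rfl
    (fun y hy => (h.AB y ((mem_cell_Ioo l u y).1 hy).1 ((mem_cell_Ioo l u y).1 hy).2).le)
    (fun y hy => (hBZ y ((mem_cell_Ioo l u y).1 hy).1 ((mem_cell_Ioo l u y).1 hy).2).le)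
  have hb₃ : Bornology.IsBounded r₃.domain := by rw [hd₃]; exact isBounded_nDom_Ioo hij l u B Z
  have g₃ : Good 2 (KZ.of r₃) := hup r₃ ⟨hij, hd₃, fun z _ => by rw [hi₃], hb₃, h.lu, hBZ, h.pole⟩
  have g₂ : Good 2 (KZ.of r₂) := good_prod_piece l u _ _ hadm hd₂ fun z _ => by rw [hi₂]
  have e₁ : KZ.of s - KZ.of r₁ ∈ KZ.relations :=
    KZ.of_sub_of_mem_relations_of_eqOn (by rw [hd₁, h.dom]) fun z hz => by rw [hi₁]; exact h.int hz
  have key : KZ.of s - (KZ.of W - KZ.of r₂ - KZ.of r₃) ∈ KZ.relations := by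
    have := sub_mem e₁ hrel
    convert this using 1; abel
  exact RebaseZero.good_of_sub_mem key (((hbig W hWN).sub g₂).sub g₃)


/-! ### Ends of affine functions -/

/-- An affine function non-negative on an open interval is non-negative at the left end.
[folklore] -/
theorem nonneg_left_end (c : Cf) (hlu : l < u) (h : ∀ y : ℝ, (l : ℝ) < y → y < u → 0 ≤ ev c y) :
    0 ≤ ev c l := by
  by_contra hneg
  push Not at hneg
  set α : ℝ := (c.1 (Fin.last 0) : ℝ) with hα
  set d : ℝ := -ev c l with hd
  have hd0 : 0 < d := by rw [hd]; linarith
  have hlu' : (l : ℝ) < u := by exact_mod_cast hlu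
  have hA : 0 < |α| + 1 := by positivity
  set δ : ℝ := min ((u - l) / 2) (d / (2 * (|α| + 1))) with hδ
  have hδ0 : 0 < δ := lt_min (by linarith) (by positivity)
  have hδ1 : δ ≤ (u - l) / 2 := min_le_left _ _
  have hδ2 : δ ≤ d / (2 * (|α| + 1)) := min_le_right _ _
  have hy := h (l + δ) (by linarith) (by linarith)
  have key : ev c (l + δ) = ev c l + α * δ := by rw [hα, ev, ev]; ring
  have h1 : α * δ ≤ |α| * δ := mul_le_mul_of_nonneg_right (le_abs_self α) hδ0.le
  have h2 : |α| * δ ≤ |α| * (d / (2 * (|α| + 1))) := mul_le_mul_of_nonneg_left hδ2 (abs_nonneg α)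
  have h3 : |α| * (d / (2 * (|α| + 1))) ≤ d / 2 := by
    rw [mul_div_assoc', div_le_div_iff₀ (by positivity) (by norm_num : (0 : ℝ) < 2)]
    nlinarith [abs_nonneg α]
  rw [key] at hy
  linarith

/-- An affine function non-negative on an open interval is non-negative at the right end.
[folklore] -/
theorem nonneg_right_end (c : Cf) (hlu : l < u) (h : ∀ y : ℝ, (l : ℝ) < y → y < u → 0 ≤ ev c y) :
    0 ≤ ev c u := by
  by_contra hneg
  push Not at hneg
  set α : ℝ := (c.1 (Fin.last 0) : ℝ) with hα
  set d : ℝ := -ev c u with hd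
  have hd0 : 0 < d := by rw [hd]; linarith
  have hlu' : (l : ℝ) < u := by exact_mod_cast hlu
  have hA : 0 < |α| + 1 := by positivity
  set δ : ℝ := min ((u - l) / 2) (d / (2 * (|α| + 1))) with hδ
  have hδ0 : 0 < δ := lt_min (by linarith) (by positivity)
  have hδ1 : δ ≤ (u - l) / 2 := min_le_left _ _
  have hδ2 : δ ≤ d / (2 * (|α| + 1)) := min_le_right _ _
  have hy := h (u - δ) (by linarith) (by linarith)
  have key : ev c (u - δ) = ev c u - α * δ := by rw [hα, ev, ev]; ring
  have h1 : -(α * δ) ≤ |α| * δ := by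
    have := mul_le_mul_of_nonneg_right (neg_abs_le α) hδ0.le
    linarith
  have h2 : |α| * δ ≤ |α| * (d / (2 * (|α| + 1))) := mul_le_mul_of_nonneg_left hδ2 (abs_nonneg α)
  have h3 : |α| * (d / (2 * (|α| + 1))) ≤ d / 2 := by
    rw [mul_div_assoc', div_le_div_iff₀ (by positivity) (by norm_num : (0 : ℝ) < 2)]
    nlinarith [abs_nonneg α]
  rw [key] at hy
  linarith

/-- The increment of an affine function over a sub-interval is at most `|slope| · length`.
[folklore] -/
theorem ev_sub_ev_le (c : Cf) {y y' : ℝ} {h : ℝ} (hyy : |y - y'| ≤ h) :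
    ev c y - ev c y' ≤ |(c.1 (Fin.last 0) : ℝ)| * h := by
  have key : ev c y - ev c y' = (c.1 (Fin.last 0) : ℝ) * (y - y') := by rw [ev, ev]; ring
  rw [key]
  calc (c.1 (Fin.last 0) : ℝ) * (y - y') ≤ |(c.1 (Fin.last 0) : ℝ) * (y - y')| := le_abs_self _
    _ = |(c.1 (Fin.last 0) : ℝ)| * |y - y'| := abs_mul _ _
    _ ≤ |(c.1 (Fin.last 0) : ℝ)| * h := mul_le_mul_of_nonneg_left hyy (abs_nonneg _)

/-! ### The vanishing base constant -/

/-- **Vanishing base constant**: the integrand vanishes, the datum is a relation. [folklore] -/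
theorem IsDN.good_zero (h : IsDN s l u A B T p a i j) (hK : Kc T p = 0) : Good 2 (KZ.of s) :=
  RebaseZero.good_of_mem_relations (KZ.of_mem_relations_of_eqOn_zero s fun z hz => by
    rw [h.int hz, Pi.zero_apply, glitB_eq_Kc, hK, zero_mul, zero_mul])

/-! ### The sides of the letters -/

/-- **The inner letter lies weakly below `A` or weakly above `B`** on the whole open interval
(non-zero base constant). [Zagier 1994, §9] -/
theorem IsDN.inner_side (h : IsDN s l u A B T p a i j) (hL : LData T a i j ci cj) (hK : Kc T p ≠ 0) :
    (∀ y : ℝ, (l : ℝ) < y → y < u → ev ci y ≤ ev A y) ∨ (∀ y : ℝ, (l : ℝ) < y → y < u → ev B y ≤ ev ci y) := by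
  obtain ⟨hnei, -⟩ := letter_ne_of_integrableOn h.ne _ A B T p a ci cj hL.hi hL.hj hL.n1 hL.n2 hK h.integrableOn
  obtain ⟨ε, hε, hP⟩ := exists_letter_sign h.ne _ A B i ci hnei
  rw [← h.dom] at hP
  rcases hε with rfl | rfl
  · refine Or.inl fun y h1 h2 => ?_
    by_contra hlt
    push Not at hlt
    set m := min (ev ci y) (ev B y) with hm
    have hAm : ev A y < m := lt_min hlt (h.AB y h1 h2)
    have hm1 := min_le_left (ev ci y) (ev B y)
    have hm2 := min_le_right (ev ci y) (ev B y)
    have hz : pt i j y ((ev A y + m) / 2) (((ev A y + m) / 2 + ev B y) / 2) ∈ s.domain := by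
      rw [h.mem, yv_pt, tv_pt_i h.ne, tv_pt_j]
      exact ⟨⟨h1, h2⟩, by linarith, by linarith, by linarith⟩
    have := hP _ hz
    rw [yv_pt, tv_pt_i h.ne, one_mul] at this
    linarith
  · refine Or.inr fun y h1 h2 => ?_
    by_contra hlt
    push Not at hlt
    set m := max (ev ci y) (ev A y) with hm
    have hmB : m < ev B y := max_lt hlt (h.AB y h1 h2)
    have hm1 := le_max_left (ev ci y) (ev A y)
    have hm2 := le_max_right (ev ci y) (ev A y)
    have hz : pt i j y ((m + ev B y) / 2) (((m + ev B y) / 2 + ev B y) / 2) ∈ s.domain := by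
      rw [h.mem, yv_pt, tv_pt_i h.ne, tv_pt_j]
      exact ⟨⟨h1, h2⟩, by linarith, by linarith, by linarith⟩
    have := hP _ hz
    rw [yv_pt, tv_pt_i h.ne] at this
    linarith

/-- **The outer letter line lies weakly below `A` or weakly above `B`** on the whole open interval
(non-zero base constant). [Zagier 1994, §9] -/
theorem IsDN.outer_side (h : IsDN s l u A B T p a i j) (hL : LData T a i j ci cj) (hK : Kc T p ≠ 0) :
    (∀ y : ℝ, (l : ℝ) < y → y < u → ev cj y ≤ ev A y) ∨ (∀ y : ℝ, (l : ℝ) < y → y < u → ev B y ≤ ev cj y) := by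
  obtain ⟨-, hnej⟩ := letter_ne_of_integrableOn h.ne _ A B T p a ci cj hL.hi hL.hj hL.n1 hL.n2 hK h.integrableOn
  obtain ⟨ε, hε, hP⟩ := exists_letter_sign h.ne _ A B j cj hnej
  rw [← h.dom] at hP
  rcases hε with rfl | rfl
  · refine Or.inl fun y h1 h2 => ?_
    by_contra hlt
    push Not at hlt
    set m := min (ev cj y) (ev B y) with hm
    have hAm : ev A y < m := lt_min hlt (h.AB y h1 h2)
    have hm1 := min_le_left (ev cj y) (ev B y)
    have hm2 := min_le_right (ev cj y) (ev B y)
    have hz : pt i j y ((ev A y + (ev A y + m) / 2) / 2) ((ev A y + m) / 2) ∈ s.domain := by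
      rw [h.mem, yv_pt, tv_pt_i h.ne, tv_pt_j]
      exact ⟨⟨h1, h2⟩, by linarith, by linarith, by linarith⟩
    have := hP _ hz
    rw [yv_pt, tv_pt_j, one_mul] at this
    linarith
  · refine Or.inr fun y h1 h2 => ?_
    by_contra hlt
    push Not at hlt
    set m := max (ev cj y) (ev A y) with hm
    have hmB : m < ev B y := max_lt hlt (h.AB y h1 h2)
    have hm1 := le_max_left (ev cj y) (ev A y)
    have hm2 := le_max_right (ev cj y) (ev A y)
    have hz : pt i j y ((ev A y + (m + ev B y) / 2) / 2) ((m + ev B y) / 2) ∈ s.domain := by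
      rw [h.mem, yv_pt, tv_pt_i h.ne, tv_pt_j]
      exact ⟨⟨h1, h2⟩, by linarith, by linarith, by linarith⟩
    have := hP _ hz
    rw [yv_pt, tv_pt_j] at this
    linarith

/-! ### The margin bound -/

/-- **The margin bound**: if the base pole and the two letters keep the distances `ρ, gᵢ, gⱼ` from
a point, the literal integrand is at most `|K|/(ρ gᵢ gⱼ)` there. [folklore] -/
theorem abs_glitB_le (hL : LData T a i j ci cj) (p : MvPolynomial (Fin 0) ℚ) (z : Fin (0 + 1 + 2) → ℝ)
    {ρ gi gj : ℝ} (hρ : 0 < ρ) (hgi : 0 < gi) (hgj : 0 < gj) (hy : ρ ≤ |yv z - T.ℓ₂.2|)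
    (hi : gi ≤ |tv z i - ev ci (yv z)|) (hj : gj ≤ |tv z j - ev cj (yv z)|) :
    |glitB T p a z| ≤ |Kc T p| / (ρ * gi * gj) := by
  rw [glitB_two T p a hL.ne ci cj hL.hi hL.hj hL.n1 hL.n2, abs_mul, abs_mul, abs_mul, abs_div, abs_div, abs_div,
    abs_one]
  have e1 : 1 / |yv z - T.ℓ₂.2| ≤ 1 / ρ := one_div_le_one_div_of_le hρ hy
  have e2 : 1 / |tv z i - ev ci (yv z)| ≤ 1 / gi := one_div_le_one_div_of_le hgi hi
  have e3 : 1 / |tv z j - ev cj (yv z)| ≤ 1 / gj := one_div_le_one_div_of_le hgj hj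
  have e0 : 0 ≤ |Kc T p| := abs_nonneg _
  calc |Kc T p| * (1 / |yv z - T.ℓ₂.2|) * (1 / |tv z i - ev ci (yv z)| * (1 / |tv z j - ev cj (yv z)|))
      ≤ |Kc T p| * (1 / ρ) * ((1 / gi) * (1 / gj)) :=
        mul_le_mul (mul_le_mul_of_nonneg_left e1 e0) (mul_le_mul e2 e3 (by positivity) (by positivity))
          (by positivity) (by positivity)
    _ = |Kc T p| / (ρ * gi * gj) := by field_simp

end RebaseE1

/-- **Registered brick `rebaseSimpleZero_E1letterSides`** (part `rebaseSimpleZero_HDiff1_of_HPar1` of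
`stub_rebaseSimpleZeroTwo`, line `janus-bands`): for a datum of the interval normal form `HDiff₁`
(`RebaseE1.IsDN`) with non-zero base constant, the constant inner letter lies weakly below the
lower bound `A` or weakly above the upper bound `B` on the whole open base interval, and so does
the outer letter line (`RebaseE1.IsDN.inner_side`, `RebaseE1.IsDN.outer_side`: absolute convergence
keeps the letter planes off the domain, the letter forms have constant signs, read near the
bounds). [Zagier 1994, §9] -/
theorem rebaseSimpleZero_E1letterSides (i j : Fin 2) (s : KZ.IntegralRep (0 + 1 + 2)) (l u : ℚ) (A B ci cj : (Fin (0 + 1) → ℚ) × ℚ) (T : RebaseZero.BData) (p : MvPolynomial (Fin 0) ℚ) (a : Fin 2 → Option ((Fin (0 + 1) → ℚ) × ℚ)) (h : RebaseE1.IsDN s l u A B T p a i j) (hL : RebaseE1.LData T a i j ci cj) (hK : RebaseDiff.Kc T p ≠ 0) : ((∀ y : ℝ, (l : ℝ) < y → y < u → RebaseZero.ev ci y ≤ RebaseZero.ev A y) ∨ (∀ y : ℝ, (l : ℝ) < y → y < u → RebaseZero.ev B y ≤ RebaseZero.ev ci y)) ∧ ((∀ y : ℝ, (l : ℝ) < y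 → y < u → RebaseZero.ev cj y ≤ RebaseZero.ev A y) ∨ (∀ y : ℝ, (l : ℝ) < y → y < u → RebaseZero.ev B y ≤ RebaseZero.ev cj y)) :=
  ⟨h.inner_side hL hK, h.outer_side hL hK⟩

end Summit.KontsevichZagierPeriods.ArrangementNormalForm.JanusBands
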